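import Literature.Analysis.FluidPDE.BarkerPrange2021TypeICriteria
import Literature.Analysis.FluidPDE.LerayHopfNSRescale
import Literature.Analysis.FluidPDE.SuitableWeakRescaling
import Literature.Analysis.FluidPDE.BarkerPrangeConcentrationProofs
import HarnessLib

/-!
# Barker–Prange 2021, Prop. 10: the tree's named fact is EQUIVALENT to the printed unit frame

Analysis/FluidPDE proof file (theorems only, no definitions, no named facts) for the named fact
`Literature.Analysis.FluidPDE.barkerPrange2021_regular_of_relative_smallness`
(`BarkerPrange2021TypeICriteria.lean`; T. Barker, C. Prange, *Quantitative regularity for the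
Navier–Stokes equations via spatial concentration*, Comm. Math. Phys. 385 (2021) 717–792 =
arXiv:2003.06717, **Proposition 10**, §4.3 p. 25).

The fact is recorded "on the tree's Leray–Hopf frame `[0,T]`, `T > 0`, for every `ν > 0`" with
the claim (module docstring of the statement file, *Viscosity, time origin, scaling*) that this
general frame follows from the printed one (`ν = 1` on `ℝ³ × [-1,0]`, datum at `-1`, final time
`0`, annulus `B_0(exp((M♭)^{1221})) ∖ B_0(1)`) by "first the Navier–Stokes scaling
`w(y,s) = λu(x₀ + λy, T + λ²s)`, `λ = √T` …, then `w(y,s) = ν⁻¹u(y,s/ν)` for the viscosity".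
This file PROVES that claim, i.e. the first line of the printed proof of the main estimates
("Without loss of generality, we now take `t₀ = 0`. We also assume that `T = 1`. The general
statement is obtained by scaling.", arXiv p. 14, §3.2):

* `BarkerPrange2021.regular_of_unitFrame` — the scaling step for ONE solution and arbitrary
  radius/threshold data `(R, η)`: if every unit-viscosity suitable Leray–Hopf solution on `[0,1]`
  with `‖w₀‖_{L³} ≤ M` and `‖w(1)‖_{L³(1 ≤ |y| < R)} ≤ η` is essentially bounded on a backward
  cylinder at `(1, 0)`, then every viscosity-`ν` suitable Leray–Hopf solution on `[0,T]` with
  `‖u₀‖_{L³} ≤ νM` and `‖u(T)‖_{L³(√(νT) ≤ |x| < √(νT) R)} ≤ νη` is essentially bounded on a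
  backward cylinder at `(T, 0)` — via the combined rescaling
  `w(s, y) = (ℓ/ν) u(T s, ℓ y)`, `q = (ℓ/ν)² p(T s, ℓ y)`, `ℓ = √(νT)`
  (`IsLerayHopfOn.viscosityRescale` then `isLerayHopfOn_nsRescale`;
  `IsSuitableWeakSolutionOn.stRescale` with `α = ℓ/ν`, `γ = ℓ`, `β = T`), the scaling of `L³`
  norms on dilated sets, and the transport of essential suprema along the space–time affine map
  (`eLpNorm_top_uncurry_smul_stPull_preimage`);
* `barkerPrange2021_regular_of_relative_smallness_iff_unitFrame` — the named fact is equivalent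
  to its instance `ν = T = 1` (the printed Proposition 10 translated in time by `+1`, in the
  tree's vocabulary), and `barkerPrange2021_regular_of_relative_smallness_of_unitFrame` — the
  direction a future discharge of the fact will use.

Nothing here proves Proposition 10 itself: its printed proof (p. 25: backward propagation of
vorticity concentration as in Lemma 6, Steps 1–4 of §3.3 with one time scale — quantitative
Carleman unique continuation / backward uniqueness on quantitative epochs and annuli of
regularity with `M♭ = exp(L_* M⁵/2)`) needs the paper's effective machinery (Thm. 11 / Rem. 11,
Lemma 6, §6 Cor. 23, §7, Step 4), which the tree does not have yet; the fact stays a named fact.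

## References

* T. Barker, C. Prange, Comm. Math. Phys. 385 (2021) 717–792 = arXiv:2003.06717: Prop. 10
  (§4.3 p. 25), §3.2 p. 14 (reduction to `t₀ = 0`, `T = 1` by scaling), §1.4.3 (classes).
  [`BarkerPrange2021`]
* L. Caffarelli, R. Kohn, L. Nirenberg, Comm. Pure Appl. Math. 35 (1982), §1–§2 (scaling of
  weak and suitable weak solutions). [`CaffarelliKohnNirenberg1982`]
-/

noncomputable section

open MeasureTheory Set Function Metric Filter
open _root_.Topology
open scoped ENNReal

namespace Literature.Analysis.FluidPDE

namespace BarkerPrange2021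

/-! ### Changes of variables -/

/-- **`L^p` norms on dilated sets under `y ↦ x₀ + ℓ y`** (`ℓ > 0`, `p < ∞`):
`‖F(x₀ + ℓ ·)‖_{L^p(A⁻¹ S)} = (ℓ⁻³)^{1/p} ‖F‖_{L^p(S)}` for `A y = x₀ + ℓ y` (Lebesgue measure on
`ℝ³` scales by `ℓ³`). The ball case is `eLpNorm_comp_add_smul_ball`. [folklore] -/
private theorem eLpNorm_comp_add_smul_preimage {F' : Type*} [NormedAddCommGroup F']
    (F : EuclideanSpace ℝ (Fin 3) → F') (x₀ : EuclideanSpace ℝ (Fin 3)) {l : ℝ} (hl : 0 < l)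
    (S : Set (EuclideanSpace ℝ (Fin 3))) {p : ℝ≥0∞} (hp : p ≠ ∞) :
    eLpNorm (fun y => F (x₀ + l • y)) p
        (volume.restrict ((fun y : EuclideanSpace ℝ (Fin 3) => x₀ + l • y) ⁻¹' S)) =
      ENNReal.ofReal ((l ^ 3)⁻¹) ^ (1 / p).toReal * eLpNorm F p (volume.restrict S) := by
  set e := spaceAffineHomeomorph hl.ne' x₀ with he
  have hme : MeasurableEmbedding e := e.measurableEmbedding
  have hcoe : (e : EuclideanSpace ℝ (Fin 3) → EuclideanSpace ℝ (Fin 3)) = fun y => x₀ + l • y :=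
    rfl
  have h1 := hme.restrict_map (volume : Measure (EuclideanSpace ℝ (Fin 3))) S
  have h2 := hme.eLpNorm_map_measure (g := F) (p := p) (μ := volume.restrict (e ⁻¹' S))
  rw [hcoe] at h1 h2
  rw [show (fun y => F (x₀ + l • y)) = F ∘ fun y => x₀ + l • y from rfl, ← h2, ← h1,
    map_space_affine_volume hl x₀, finrank_euclideanSpace_fin, Measure.restrict_smul,
    eLpNorm_smul_measure_of_ne_top hp, smul_eq_mul]

/-- The dilation `y ↦ ℓ y` (`ℓ > 0`) pulls the half-open shell `{ℓ ≤ |x| < ℓ R}` back to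
`{1 ≤ |y| < R}`. [folklore] -/
private theorem preimage_smul_shell {l : ℝ} (hl : 0 < l) (R : ℝ) :
    (fun y : EuclideanSpace ℝ (Fin 3) => (0 : EuclideanSpace ℝ (Fin 3)) + l • y) ⁻¹'
        {x : EuclideanSpace ℝ (Fin 3) | l ≤ ‖x‖ ∧ ‖x‖ < l * R} =
      {y : EuclideanSpace ℝ (Fin 3) | 1 ≤ ‖y‖ ∧ ‖y‖ < R} := by
  ext y
  simp only [mem_preimage, mem_setOf_eq, zero_add, norm_smul, Real.norm_eq_abs, abs_of_pos hl]
  rw [le_mul_iff_one_le_right hl, mul_lt_mul_iff_of_pos_left hl]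

/-- The parabolic rescaling `Φ(s, y) = (T s, ℓ y)` (`T > 0`) pulls the open slab `(0, T) × ℝ³`
back to `(0, 1) × ℝ³`. [folklore] -/
private theorem stPreimage_slab_Ioo_unit {T : ℝ} (hT : 0 < T) (l : ℝ) :
    stPreimage T l 0 (0 : EuclideanSpace ℝ (Fin 3))
        (slab (EuclideanSpace ℝ (Fin 3)) (Ioo 0 T) isOpen_Ioo) =
      slab (EuclideanSpace ℝ (Fin 3)) (Ioo 0 1) isOpen_Ioo := by
  ext z
  simp only [coe_stPreimage, mem_preimage, SetLike.mem_coe, mem_slab, stAffine_fst, zero_add,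
    mem_Ioo]
  constructor
  · rintro ⟨h1, h2⟩
    refine ⟨(mul_pos_iff_of_pos_left hT).1 h1, ?_⟩
    have h3 : T * z.1 < T * 1 := by rwa [mul_one]
    exact lt_of_mul_lt_mul_left h3 hT.le
  · rintro ⟨h1, h2⟩
    refine ⟨mul_pos hT h1, ?_⟩
    calc T * z.1 < T * 1 := mul_lt_mul_of_pos_left h2 hT
      _ = T := mul_one T

/-! ### The scaling step -/

/-- **The scaling step of Barker–Prange 2021, Prop. 10** ("The general statement is obtained by
scaling", arXiv p. 14), for one solution and arbitrary radius/threshold data `R, η`. Suppose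
that every unit-viscosity Leray–Hopf solution `w` on `[0, 1] × ℝ³`, suitable on the open slab,
with `‖w₀‖_{L³} ≤ M` and `‖w(1)‖_{L³({1 ≤ |y| < R})} ≤ η` is essentially bounded on some backward
cylinder `(1 - r², 1) × B_r(0)`. Then every viscosity-`ν` Leray–Hopf solution `u` on `[0, T] × ℝ³`
(`ν, T > 0`), suitable on the open slab, with `‖u₀‖_{L³} ≤ νM` and
`‖u(T)‖_{L³({√(νT) ≤ |x| < √(νT) R})} ≤ νη` is essentially bounded on some backward cylinder
`(T - ρ², T) × B_ρ(0)`: apply the hypothesis to `w(s, y) = (ℓ/ν) u(T s, ℓ y)`,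
`q(s, y) = (ℓ/ν)² p(T s, ℓ y)`, `w₀ = (ℓ/ν) u₀(ℓ ·)`, `ℓ = √(νT)` (Leray–Hopf by
`IsLerayHopfOn.viscosityRescale` and `isLerayHopfOn_nsRescale`; suitable by
`IsSuitableWeakSolutionOn.stRescale`; `‖w₀‖_{L³} = ν⁻¹‖u₀‖_{L³}`,
`‖w(1)‖_{L³(1 ≤ |y| < R)} = ν⁻¹‖u(T)‖_{L³(ℓ ≤ |x| < ℓR)}`), and pull the essential bound back along
`Φ(s, y) = (T s, ℓ y)`, which maps `(T - ρ², T) × B_ρ(0)`, `ρ = r min(ℓ, √T)`, into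
`(1 - r², 1) × B_r(0)`. [cite: BarkerPrange2021, §3.2 p. 14 and Prop. 10 (§4.3 p. 25); CaffarelliKohnNirenberg1982, §2] -/
theorem regular_of_unitFrame {M R η : ℝ}
    (hunit : ∀ (w₀ : EuclideanSpace ℝ (Fin 3) → EuclideanSpace ℝ (Fin 3))
      (w : ℝ → EuclideanSpace ℝ (Fin 3) → EuclideanSpace ℝ (Fin 3))
      (q : ℝ → EuclideanSpace ℝ (Fin 3) → ℝ),
      IsLerayHopfOn 1 1 0 w₀ w →
      IsSuitableWeakSolutionOn (slab (EuclideanSpace ℝ (Fin 3)) (Ioo 0 1) isOpen_Ioo) 1 0 w q →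
      eLpNorm w₀ 3 volume ≤ ENNReal.ofReal M →
      eLpNorm (w 1) 3 (volume.restrict
          {y : EuclideanSpace ℝ (Fin 3) | 1 ≤ ‖y‖ ∧ ‖y‖ < R}) ≤ ENNReal.ofReal η →
      ∃ r : ℝ, 0 < r ∧
        eLpNorm (uncurry w) ∞
          (volume.restrict (parabolicCylinder r ((1 : ℝ), (0 : EuclideanSpace ℝ (Fin 3))))) < ∞)
    {ν T : ℝ} (hν : 0 < ν) (hT : 0 < T)
    {u₀ : EuclideanSpace ℝ (Fin 3) → EuclideanSpace ℝ (Fin 3)}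
    {u : ℝ → EuclideanSpace ℝ (Fin 3) → EuclideanSpace ℝ (Fin 3)}
    {p : ℝ → EuclideanSpace ℝ (Fin 3) → ℝ}
    (hLH : IsLerayHopfOn T ν 0 u₀ u)
    (hsuit : IsSuitableWeakSolutionOn (slab (EuclideanSpace ℝ (Fin 3)) (Ioo 0 T) isOpen_Ioo) ν 0 u p)
    (h₀ : eLpNorm u₀ 3 volume ≤ ENNReal.ofReal (ν * M))
    (h₁ : eLpNorm (u T) 3 (volume.restrict
        {x : EuclideanSpace ℝ (Fin 3) | Real.sqrt (ν * T) ≤ ‖x‖ ∧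
          ‖x‖ < Real.sqrt (ν * T) * R}) ≤ ENNReal.ofReal (ν * η)) :
    ∃ ρ : ℝ, 0 < ρ ∧
      eLpNorm (uncurry u) ∞
        (volume.restrict (parabolicCylinder ρ ((T : ℝ), (0 : EuclideanSpace ℝ (Fin 3))))) < ∞ := by
  -- ## the scale `ℓ = √(νT)` and the rescaled triple
  set l : ℝ := Real.sqrt (ν * T) with hl_def
  have hl : 0 < l := Real.sqrt_pos.2 (mul_pos hν hT)
  have hl0 : l ≠ 0 := hl.ne'
  have hl2 : l ^ 2 = ν * T := Real.sq_sqrt (mul_pos hν hT).le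
  have hν0 : ν ≠ 0 := hν.ne'
  set w : ℝ → EuclideanSpace ℝ (Fin 3) → EuclideanSpace ℝ (Fin 3) :=
    (l / ν) • stPull T l 0 (0 : EuclideanSpace ℝ (Fin 3)) u with hw_def
  set q : ℝ → EuclideanSpace ℝ (Fin 3) → ℝ :=
    (l / ν) ^ 2 • stPull T l 0 (0 : EuclideanSpace ℝ (Fin 3)) p with hq_def
  set w₀ : EuclideanSpace ℝ (Fin 3) → EuclideanSpace ℝ (Fin 3) := nsRescaleData l (ν⁻¹ • u₀)
    with hw₀_def
  -- ## (1) `w` is a unit-viscosity Leray–Hopf solution on `[0, 1]` with datum `w₀`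
  have hv := hLH.viscosityRescale (inv_pos.2 hν)
  rw [timeRescale_zero_force] at hv
  have hw := isLerayHopfOn_nsRescale hv hl
  have e1 : T / ν⁻¹ / l ^ 2 = 1 := by
    rw [hl2]; field_simp
  have e2 : ν⁻¹ * ν = 1 := inv_mul_cancel₀ hν0
  have e3 : nsRescaleForce l (0 : ℝ → EuclideanSpace ℝ (Fin 3) → EuclideanSpace ℝ (Fin 3)) = 0 := by
    funext t x; simp
  have e4 : FluidPDE.nsRescale l (timeRescale ν⁻¹ ν⁻¹ u) = w := by
    funext s y
    rw [nsRescale_apply, timeRescale_apply, hw_def, smul_stPull_apply, zero_add, zero_add,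
      smul_smul]
    have ea : l * ν⁻¹ = l / ν := by rw [div_eq_mul_inv]
    have eb : ν⁻¹ * (l ^ 2 * s) = T * s := by rw [hl2]; field_simp
    rw [ea, eb]
  rw [e1, e2, e3, e4] at hw
  -- ## (2) `(w, q)` is suitable on the open slab `(0, 1) × ℝ³`
  have hs := hsuit.stRescale (α := l / ν) (β := T) (γ := l) (by positivity) hl
    (by rw [div_mul_eq_mul_div, ← sq, hl2]; field_simp) 0 (0 : EuclideanSpace ℝ (Fin 3))
  have e5 : l / ν * ν / l = 1 := by field_simp
  have e6 : ((l / ν) ^ 2 * l) • stPull T l 0 (0 : EuclideanSpace ℝ (Fin 3))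
      (0 : ℝ → EuclideanSpace ℝ (Fin 3) → EuclideanSpace ℝ (Fin 3)) = 0 := by
    funext s y; simp [stPull_apply]
  rw [stPreimage_slab_Ioo_unit hT, e5, e6] at hs
  -- ## (3) the datum: `‖w₀‖_{L³} = ν⁻¹ ‖u₀‖_{L³} ≤ M`
  have hw₀ : eLpNorm w₀ 3 volume ≤ ENNReal.ofReal M := by
    rw [hw₀_def, eLpNorm_nsRescaleData_of_ne_zero 3 _ hl0, finrank_euclideanSpace_fin,
      abs_of_nonneg (by positivity), ofReal_inv_cube_rpow_third hl, eLpNorm_const_smul,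
      Real.enorm_eq_ofReal hl.le, Real.enorm_eq_ofReal (inv_pos.2 hν).le,
      ← ENNReal.ofReal_mul hl.le, mul_inv_cancel₀ hl0, ENNReal.ofReal_one, one_mul]
    calc ENNReal.ofReal ν⁻¹ * eLpNorm u₀ 3 volume
        ≤ ENNReal.ofReal ν⁻¹ * ENNReal.ofReal (ν * M) := by gcongr
      _ = ENNReal.ofReal M := by
          rw [← ENNReal.ofReal_mul (inv_pos.2 hν).le]
          congr 1
          field_simp
  -- ## (4) the final slice: `‖w(1)‖_{L³(1 ≤ |y| < R)} = ν⁻¹ ‖u(T)‖_{L³(ℓ ≤ |x| < ℓR)} ≤ η`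
  have hw1 : eLpNorm (w 1) 3 (volume.restrict
      {y : EuclideanSpace ℝ (Fin 3) | 1 ≤ ‖y‖ ∧ ‖y‖ < R}) ≤ ENNReal.ofReal η := by
    have ew : w 1 = (l / ν) • fun y => u T ((0 : EuclideanSpace ℝ (Fin 3)) + l • y) := by
      funext y
      simp only [hw_def, smul_stPull_apply, Pi.smul_apply, mul_one, zero_add]
    rw [ew, eLpNorm_const_smul, ← preimage_smul_shell hl R,
      eLpNorm_comp_add_smul_preimage (u T) 0 hl _ (by norm_num), ofReal_inv_cube_rpow_third hl,
      Real.enorm_eq_ofReal (by positivity : (0 : ℝ) ≤ l / ν)]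
    calc ENNReal.ofReal (l / ν) * (ENNReal.ofReal l⁻¹ * eLpNorm (u T) 3 (volume.restrict
          {x : EuclideanSpace ℝ (Fin 3) | l ≤ ‖x‖ ∧ ‖x‖ < l * R}))
        ≤ ENNReal.ofReal (l / ν) * (ENNReal.ofReal l⁻¹ * ENNReal.ofReal (ν * η)) := by gcongr
      _ = ENNReal.ofReal η := by
          rw [← ENNReal.ofReal_mul (inv_pos.2 hl).le, ← ENNReal.ofReal_mul (by positivity)]
          congr 1
          field_simp
  -- ## (5) the unit-frame statement applied to `(w₀, w, q)`
  obtain ⟨r, hr, hfin⟩ := hunit w₀ w q hw hs hw₀ hw1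
  -- ## (6) transport of the essential bound back along `Φ(s, y) = (T s, ℓ y)`
  set m : ℝ := min l (Real.sqrt T) with hm_def
  have hm : 0 < m := lt_min hl (Real.sqrt_pos.2 hT)
  have hml : m ≤ l := min_le_left _ _
  have hmT : m ^ 2 ≤ T := by
    have h1 : m ≤ Real.sqrt T := min_le_right _ _
    calc m ^ 2 ≤ Real.sqrt T ^ 2 := by gcongr
      _ = T := Real.sq_sqrt hT.le
  set ρ : ℝ := r * m with hρ_def
  have hρ : 0 < ρ := mul_pos hr hm
  refine ⟨ρ, hρ, ?_⟩
  set S : Set (ℝ × EuclideanSpace ℝ (Fin 3)) :=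
    parabolicCylinder ρ ((T : ℝ), (0 : EuclideanSpace ℝ (Fin 3))) with hS_def
  have hpre : stAffine T l 0 (0 : EuclideanSpace ℝ (Fin 3)) ⁻¹' S =
      Ioo ((T - ρ ^ 2 - 0) / T) ((T - 0) / T) ×ˢ
        ball (l⁻¹ • ((0 : EuclideanSpace ℝ (Fin 3)) - 0)) (ρ / l) := by
    rw [hS_def, parabolicCylinder, stAffine_preimage_cylinder hT hl]
  have hsub : stAffine T l 0 (0 : EuclideanSpace ℝ (Fin 3)) ⁻¹' S ⊆
      parabolicCylinder r ((1 : ℝ), (0 : EuclideanSpace ℝ (Fin 3))) := by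
    rw [hpre, sub_zero, sub_zero, div_self hT.ne', sub_self, smul_zero]
    rintro ⟨s, y⟩ ⟨hs', hy⟩
    rw [mem_parabolicCylinder]
    refine ⟨⟨?_, hs'.2⟩, ?_⟩
    · have h1 : (T - ρ ^ 2) / T = 1 - ρ ^ 2 / T := by field_simp
      have h2 : ρ ^ 2 / T ≤ r ^ 2 := by
        rw [div_le_iff₀ hT, hρ_def, mul_pow]
        exact mul_le_mul_of_nonneg_left hmT (sq_nonneg r)
      have h3 := hs'.1
      rw [h1] at h3
      dsimp only
      linarith
    · rw [mem_ball] at hy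
      have h4 : ρ / l ≤ r := by
        rw [div_le_iff₀ hl, hρ_def]
        exact mul_le_mul_of_nonneg_left hml hr.le
      exact lt_of_lt_of_le hy h4
  have key := eLpNorm_top_uncurry_smul_stPull_preimage hT hl 0 (0 : EuclideanSpace ℝ (Fin 3))
    (l / ν) u S
  have hle : eLpNorm (uncurry w) ∞
      (volume.restrict (stAffine T l 0 (0 : EuclideanSpace ℝ (Fin 3)) ⁻¹' S)) < ∞ :=
    lt_of_le_of_lt (eLpNorm_mono_measure _ (Measure.restrict_mono hsub le_rfl)) hfin
  rw [hw_def] at hle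
  rw [key] at hle
  have ha : ‖l / ν‖ₑ ≠ 0 := by
    rw [Real.enorm_eq_ofReal (by positivity : (0 : ℝ) ≤ l / ν)]
    exact (ENNReal.ofReal_pos.2 (by positivity)).ne'
  rcases ENNReal.mul_lt_top_iff.1 hle with (⟨-, h⟩ | h | h)
  · exact h
  · exact absurd h ha
  · rw [h]; exact ENNReal.zero_lt_top

end BarkerPrange2021

/-! ### The named fact and its unit frame -/

/-- **Barker–Prange 2021, Prop. 10: the tree's fact is equivalent to its unit frame.** The named
fact `barkerPrange2021_regular_of_relative_smallness` (every `ν > 0`, `T > 0`; datum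
`‖u₀‖_{L³} ≤ νM`; final slice `L³`-small on `√(νT) ≤ |x| < √(νT) exp((M♭)^{1221})`; `(T, 0)`
regular) holds iff its instance `ν = T = 1` holds — the printed Proposition 10 (unit viscosity,
`ℝ³ × [-1, 0]`, `‖u(·,-1)‖_{L³} ≤ M`,
`‖u(·,0)‖_{L³(B_0(exp((M♭)^{1221})) ∖ B_0(1))} ≤ exp(-exp((M♭)^{1223}))` ⇒ `(0,0)` regular,
`M♭ = exp(L M⁵/2)`) translated in time by `+1` and written in the tree's vocabulary. Forward:
specialise. Backward: the scaling step `BarkerPrange2021.regular_of_unitFrame`.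
[cite: BarkerPrange2021, Prop. 10 (§4.3 p. 25) and §3.2 p. 14] -/
theorem barkerPrange2021_regular_of_relative_smallness_iff_unitFrame :
    barkerPrange2021_regular_of_relative_smallness ↔
    ∃ M₀ : ℝ, 1 ≤ M₀ ∧ ∃ L : ℝ, 0 < L ∧ ∀ M : ℝ, M₀ ≤ M →
      ∀ (w₀ : EuclideanSpace ℝ (Fin 3) → EuclideanSpace ℝ (Fin 3))
        (w : ℝ → EuclideanSpace ℝ (Fin 3) → EuclideanSpace ℝ (Fin 3))
        (q : ℝ → EuclideanSpace ℝ (Fin 3) → ℝ),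
        IsLerayHopfOn 1 1 0 w₀ w →
        IsSuitableWeakSolutionOn (slab (EuclideanSpace ℝ (Fin 3)) (Ioo 0 1) isOpen_Ioo) 1 0 w q →
        eLpNorm w₀ 3 volume ≤ ENNReal.ofReal M →
        eLpNorm (w 1) 3 (volume.restrict
            {y : EuclideanSpace ℝ (Fin 3) | 1 ≤ ‖y‖ ∧
              ‖y‖ < Real.exp (Real.exp (L * M ^ 5 / 2) ^ (1221 : ℕ))}) ≤
          ENNReal.ofReal (Real.exp (-Real.exp (Real.exp (L * M ^ 5 / 2) ^ (1223 : ℕ)))) →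
        ∃ r : ℝ, 0 < r ∧
          eLpNorm (uncurry w) ∞
            (volume.restrict (parabolicCylinder r ((1 : ℝ), (0 : EuclideanSpace ℝ (Fin 3))))) < ∞ := by
  constructor
  · rintro ⟨M₀, hM₀, L, hL, hfact⟩
    refine ⟨M₀, hM₀, L, hL, fun M hM w₀ w q hLH hsuit h₀ h₁ => ?_⟩
    have h₀' : eLpNorm w₀ 3 volume ≤ ENNReal.ofReal (1 * M) := by rwa [one_mul]
    have h₁' : eLpNorm (w 1) 3 (volume.restrict
        {x : EuclideanSpace ℝ (Fin 3) | Real.sqrt (1 * 1) ≤ ‖x‖ ∧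
          ‖x‖ < Real.sqrt (1 * 1) * Real.exp (Real.exp (L * M ^ 5 / 2) ^ (1221 : ℕ))}) ≤
        ENNReal.ofReal (1 * Real.exp (-Real.exp (Real.exp (L * M ^ 5 / 2) ^ (1223 : ℕ)))) := by
      rwa [mul_one, Real.sqrt_one, one_mul, one_mul]
    exact hfact M hM 1 1 one_pos one_pos w₀ w q hLH hsuit h₀' h₁'
  · rintro ⟨M₀, hM₀, L, hL, hunit⟩
    refine ⟨M₀, hM₀, L, hL, fun M hM ν T hν hT u₀ u p hLH hsuit h₀ h₁ => ?_⟩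
    exact BarkerPrange2021.regular_of_unitFrame (hunit M hM) hν hT hLH hsuit h₀ h₁

/-- **The direction a discharge will use**: the printed unit-frame Proposition 10 (in the tree's
vocabulary, time translated by `+1`) implies the named fact
`barkerPrange2021_regular_of_relative_smallness` for every viscosity and every final time.
[cite: BarkerPrange2021, Prop. 10 (§4.3 p. 25) and §3.2 p. 14] -/
theorem barkerPrange2021_regular_of_relative_smallness_of_unitFrame
    (hunit : ∃ M₀ : ℝ, 1 ≤ M₀ ∧ ∃ L : ℝ, 0 < L ∧ ∀ M : ℝ, M₀ ≤ M →
      ∀ (w₀ : EuclideanSpace ℝ (Fin 3) → EuclideanSpace ℝ (Fin 3))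
        (w : ℝ → EuclideanSpace ℝ (Fin 3) → EuclideanSpace ℝ (Fin 3))
        (q : ℝ → EuclideanSpace ℝ (Fin 3) → ℝ),
        IsLerayHopfOn 1 1 0 w₀ w →
        IsSuitableWeakSolutionOn (slab (EuclideanSpace ℝ (Fin 3)) (Ioo 0 1) isOpen_Ioo) 1 0 w q →
        eLpNorm w₀ 3 volume ≤ ENNReal.ofReal M →
        eLpNorm (w 1) 3 (volume.restrict
            {y : EuclideanSpace ℝ (Fin 3) | 1 ≤ ‖y‖ ∧
              ‖y‖ < Real.exp (Real.exp (L * M ^ 5 / 2) ^ (1221 : ℕ))}) ≤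
          ENNReal.ofReal (Real.exp (-Real.exp (Real.exp (L * M ^ 5 / 2) ^ (1223 : ℕ)))) →
        ∃ r : ℝ, 0 < r ∧
          eLpNorm (uncurry w) ∞
            (volume.restrict (parabolicCylinder r ((1 : ℝ), (0 : EuclideanSpace ℝ (Fin 3))))) < ∞) :
    barkerPrange2021_regular_of_relative_smallness :=
  barkerPrange2021_regular_of_relative_smallness_iff_unitFrame.2 hunit

end Literature.Analysis.FluidPDE

end
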